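import Literature.Probability.RandomPlanarGeometry.SAWTiltedFiniteMemory
import HarnessLib

/-!
# Diagonally tilted memory-16 certificate, tilt `r = 7/6` along `e₀ + e₁` (`θ = 0.1542`): `λ̄ = 2.830067`

Topic `Literature/Probability/RandomPlanarGeometry`. One compiled evaluation of
`FiniteMemory.checkD 16 7 6 118862805 1000000 60` (`SAWTiltedFiniteMemory.lean`): the memory-16
Pönitz–Tittmann automaton on `ℤ²` (`467 249` states) with the DIAGONAL letter weights
`W(+e₀) = W(+e₁) = 49`, `W(-e₀) = W(-e₁) = 36` (`= 42 · (7/6)^{dx+dy}`), 60 rounds of weighted power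
iteration and the verified weighted Collatz–Wielandt check with ratio `118862805/1000000`, i.e.
`λ̄ = 118862805/(1000000·42) = 2.830067 ≥ λ₁₆^diag(θ = 0.1542)`. Used by the eight-direction form of the
explicit sub-ballisticity theorem (`SAWSubBallisticEightDirections.lean`): diagonal speed threshold
`log(λ̄/2.604)/(1.3065 θ) = 0.4134`. Axiom: `Lean.ofReduceBool` (`native_decide`,
`computational`); ≈ 4–5 minutes.

## References

* H. Duminil-Copin, A. Hammond, *Self-avoiding walk is sub-ballistic*, CMP 324 (2013), Thm 1.1 [DuminilCopinHammond2013].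
* A. Pönitz, P. Tittmann, Electron. J. Combin. 7 (2000) R21, §3 [PonitzTittmann2000].
-/

namespace Literature.Probability.RandomPlanarGeometry.SAW.FiniteMemory

/-- The diagonally tilted memory-16 certificate with tilt `7/6` evaluates to `true` (ratio `118862805/1000000`).
[cite: PonitzTittmann2000, §3] -/
theorem checkD_16_7_6 : checkD 16 7 6 118862805 1000000 60 = true := by
  native_decide

end Literature.Probability.RandomPlanarGeometry.SAW.FiniteMemory
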